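import Summits.AtomisticToContinuum.BoseEinsteinCondensation.Theorems.KineticLatticeBEC.Negative.Toolkit

/-!
# Negative lemmas for crux `KineticLatticeBEC` (stmt-AtomisticToContinuum-9671), III: the Casimir
ceiling — any admissible constant is `≤ ½`

Supports (does not close) stmt-AtomisticToContinuum-9671. For EVERY vector,
`Re⟨v, ((S¹_tot)²+(S²_tot)²) v⟩ ≤ (|Λ|²/4 + |Λ|/2)‖v‖²` (`re_quad_obsO_le`; Cauchy–Schwarz and the double
counting `sum_flip`, i.e. Tóth's `‖S⁺_tot v‖² ≤ Σ_τ #↓τ(|Λ| − #↓τ + 1)|v_τ|²`), hence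
`rhs L N ≤ L⁶/4 + N` (`rhs_le`) and, testing the crux at half filling `N = L³/2`,
`constant_le_half : KineticLatticeBECWith c L₀ → c ≤ ½`; the strengthenings `c > ½`, in particular the
zero-depletion version `c = 1`, are refuted (`not_kineticLatticeBECWith_of_half_lt`,
`not_kineticLatticeBECWith_one`).
-/

noncomputable section

namespace Summit.AtomisticToContinuum.BoseEinsteinCondensation.Theorems.KineticLatticeBEC.Negative

open scoped BigOperators ComplexOrder
open Literature.MathematicalPhysics.QuantumLattice Literature.Probability.LatticeModels Matrix Finset
open Summit.AtomisticToContinuum.BoseEinsteinCondensation.Theses.BECStronglyRayleigh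
open Summit.AtomisticToContinuum.BoseEinsteinCondensation.Theorems.LatticeODLROOffHalfFilling.Negative

/-! ### §3 (b) TIGHTNESS of the constant: `c ≤ ½` (the Casimir / Tóth ceiling at half filling)

For EVERY vector `v` (no ground-state or sector input):
`Re⟨v, ((S¹_tot)²+(S²_tot)²) v⟩ ≤ (|Λ|²/4 + |Λ|/2)‖v‖²` — the spin-½ Casimir ceiling
`(S¹)²+(S²)² ≤ 𝐒² ≤ S_max(S_max+1)`, `S_max = |Λ|/2`, proved here by Cauchy–Schwarz and double
counting in the configuration basis (`‖S⁺_tot v‖² ≤ Σ_τ #↓τ(|Λ| − #↓τ + 1)|v_τ|²`, Tóth's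
combinatorics). At half filling `N = L³/2` the crux demands `c·L⁶/2 ≤ Re ω(O) ≤ L⁶/4 + L³/2`, so
ANY admissible constant has `c ≤ ½` (`constant_le_half`); spin-wave / QMC estimates for the 3-D
quantum XY model give `N₀/N = 2m² ≈ 0.4` there (`m ≈ 0.45` of `½`), so the ceiling is nearly attained
and the crux is only plausible with `c < ½`; exact diagonalisation (job j013112) gives `N₀/N = 0.594`
on the `2³` torus at half filling (Tóth ceiling `0.625`).
Combined with the sibling disprover's `four_le_const` (crux K1 forces `M ≥ 4`), the route's own
constant is `c = 1/max(M,1) ≤ ¼`. -/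

section Casimir

variable {Λ : Type*} [Fintype Λ] [DecidableEq Λ]

/-- `Re⟨w, w⟩ = Σ_i ‖w_i‖²`. [folklore] -/
theorem re_star_dotProduct_self {m : Type*} [Fintype m] (w : m → ℂ) :
    (star w ⬝ᵥ w).re = ∑ i, ‖w i‖ ^ 2 := by
  rw [dotProduct, Complex.re_sum]
  refine Finset.sum_congr rfl fun i _ => ?_
  rw [Pi.star_apply, Complex.star_def, Complex.conj_mul']
  norm_cast

/-- `Re⟨v, S³_tot v⟩ = Σ_σ (|Λ|/2 − #↓σ)‖v σ‖²`. [folklore] -/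
theorem re_quad_totalSpin_two (v : TensorIndex Λ 2 → ℂ) :
    (star v ⬝ᵥ (totalSpin 1 2 : Op Λ 2) *ᵥ v).re =
      ∑ σ, ((Fintype.card Λ : ℝ) / 2 - downCount σ) * ‖v σ‖ ^ 2 := by
  rw [totalSpin_two_eq, sub_mulVec, smul_mulVec, one_mulVec, dotProduct_sub, dotProduct_smul,
    smul_eq_mul, quad_sumPd, Complex.sub_re, Complex.ofReal_re]
  have : ((Fintype.card Λ : ℂ) / 2) = (((Fintype.card Λ : ℝ) / 2 : ℝ) : ℂ) := by push_cast; ring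
  rw [this, Complex.re_ofReal_mul, re_star_dotProduct_self, Finset.mul_sum, ← Finset.sum_sub_distrib]
  refine Finset.sum_congr rfl fun σ _ => ?_
  ring

/-- `(S⁺_tot v)(σ) = Σ_{x : σ_x = ↑} v(σ with x ↓)`. [folklore] -/
theorem sumE_mulVec_apply (v : TensorIndex Λ 2 → ℂ) (σ : TensorIndex Λ 2) :
    ((∑ x : Λ, E x) *ᵥ v) σ = ∑ x, if σ x = 0 then v (Function.update σ x 1) else 0 := by
  rw [Matrix.sum_mulVec, Finset.sum_apply]
  exact Finset.sum_congr rfl fun x _ => E_mulVec_apply x v σ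

/-- Flipping the spin at `x`: an involution of configuration space. [folklore] -/
def flipAt (x : Λ) (σ : TensorIndex Λ 2) : TensorIndex Λ 2 := Function.update σ x (σ x).rev

omit [Fintype Λ] in
/-- Flipping twice is the identity. [folklore] -/
theorem flipAt_involutive (x : Λ) : Function.Involutive (flipAt (Λ := Λ) x) := by
  intro σ
  simp only [flipAt, Function.update_self, Fin.rev_rev, Function.update_idem, Function.update_eq_self]

/-- **Double counting** `(σ, x with σ_x = ↑) ↔ (τ, x with τ_x = ↓)`, `τ = σ^{x↓}`. [folklore] -/
theorem sum_flip (x : Λ) (g : TensorIndex Λ 2 → ℝ) :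
    ∑ σ : TensorIndex Λ 2, (if σ x = 0 then g (Function.update σ x 1) else 0) =
      ∑ τ : TensorIndex Λ 2, (if τ x = 1 then g τ else 0) := by
  rw [← Equiv.sum_comp (flipAt_involutive x).toPerm (fun τ => if τ x = 1 then g τ else 0)]
  refine Finset.sum_congr rfl fun σ _ => ?_
  simp only [Function.Involutive.coe_toPerm, flipAt, Function.update_self]
  have hr0 : (0 : Fin 2).rev = 1 := rfl
  have hr1 : (1 : Fin 2).rev = 0 := rfl
  rcases Fin.exists_fin_two.mp ⟨σ x, rfl⟩ with h | h
  · rw [if_pos h, h, hr0, if_pos rfl]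
  · rw [if_neg (by rw [h]; decide), h, hr1, if_neg (by decide)]

omit [DecidableEq Λ] in
/-- Lowering one more spin raises the down count by one. [folklore] -/
theorem downCount_update_one [DecidableEq Λ] {σ : TensorIndex Λ 2} {x : Λ} (h : σ x = 0) :
    downCount (Function.update σ x 1) = downCount σ + 1 := by
  unfold downCount
  have hs : (Finset.univ.filter fun y : Λ => Function.update σ x 1 y = 1) =
      insert x (Finset.univ.filter fun y : Λ => σ y = 1) := by
    ext y
    by_cases hy : y = x
    · subst hy
      simp
    · simp [hy]
  rw [hs, Finset.card_insert_of_notMem]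
  simp [h]

omit [DecidableEq Λ] in
/-- `#↑σ = |Λ| − #↓σ`. [folklore] -/
theorem card_filter_up (σ : TensorIndex Λ 2) :
    ((Finset.univ.filter fun x : Λ => σ x = 0).card : ℝ) = Fintype.card Λ - downCount σ := by
  have h := Finset.card_filter_add_card_filter_not (s := (Finset.univ : Finset Λ))
    (fun x : Λ => σ x = 0)
  have h2 : (Finset.univ.filter fun x : Λ => ¬ σ x = 0) = Finset.univ.filter fun x : Λ => σ x = 1 := by
    ext y
    simp only [Finset.mem_filter, Finset.mem_univ, true_and]
    rcases Fin.exists_fin_two.mp ⟨σ y, rfl⟩ with hy | hy <;> simp [hy]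
  rw [h2, Finset.card_univ] at h
  rw [downCount]
  have := congrArg (Nat.cast (R := ℝ)) h
  push_cast at this
  linarith

/-- **Cauchy–Schwarz per configuration**: `|(S⁺_tot v)(σ)|² ≤ #↑σ · Σ_{x:σ_x=↑} |v(σ^{x↓})|²`.
[folklore] -/
theorem normSq_sumE_mulVec_le (v : TensorIndex Λ 2 → ℂ) (σ : TensorIndex Λ 2) :
    ‖((∑ x : Λ, E x) *ᵥ v) σ‖ ^ 2 ≤ ((Fintype.card Λ : ℝ) - downCount σ) *
      ∑ x, (if σ x = 0 then ‖v (Function.update σ x 1)‖ ^ 2 else 0) := by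
  rw [sumE_mulVec_apply, ← Finset.sum_filter, ← Finset.sum_filter, ← card_filter_up]
  set s := Finset.univ.filter fun x : Λ => σ x = 0
  calc ‖∑ x ∈ s, v (Function.update σ x 1)‖ ^ 2
      ≤ (∑ x ∈ s, ‖v (Function.update σ x 1)‖) ^ 2 := by
        gcongr
        exact norm_sum_le _ _
    _ ≤ s.card * ∑ x ∈ s, ‖v (Function.update σ x 1)‖ ^ 2 := sq_sum_le_card_mul_sum_sq

/-- **Tóth's combinatorial Casimir bound**: `‖S⁺_tot v‖² ≤ Σ_τ #↓τ (|Λ| − #↓τ + 1) |v_τ|²`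
(equality of the coefficient with `S_max(S_max+1) − M(M+1)` in the sector `M = |Λ|/2 − #↓`).
[folklore] -/
theorem normSq_sumE_mulVec_sum_le (v : TensorIndex Λ 2 → ℂ) :
    ∑ σ, ‖((∑ x : Λ, E x) *ᵥ v) σ‖ ^ 2 ≤
      ∑ τ, (downCount τ : ℝ) * (Fintype.card Λ - downCount τ + 1) * ‖v τ‖ ^ 2 := by
  set V : ℝ := (Fintype.card Λ : ℝ) with hV
  calc ∑ σ, ‖((∑ x : Λ, E x) *ᵥ v) σ‖ ^ 2
      ≤ ∑ σ : TensorIndex Λ 2, (V - downCount σ) *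
          ∑ x, (if σ x = 0 then ‖v (Function.update σ x 1)‖ ^ 2 else 0) :=
        Finset.sum_le_sum fun σ _ => normSq_sumE_mulVec_le v σ
    _ = ∑ σ : TensorIndex Λ 2, ∑ x : Λ, (if σ x = 0 then
          (V - downCount (Function.update σ x 1) + 1) * ‖v (Function.update σ x 1)‖ ^ 2 else 0) := by
        refine Finset.sum_congr rfl fun σ _ => ?_
        rw [Finset.mul_sum]
        refine Finset.sum_congr rfl fun x _ => ?_
        split_ifs with h
        · rw [downCount_update_one h]
          push_cast
          ring
        · rw [mul_zero]
    _ = ∑ x : Λ, ∑ τ : TensorIndex Λ 2, (if τ x = 1 then (V - downCount τ + 1) * ‖v τ‖ ^ 2 else 0) := by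
        rw [Finset.sum_comm]
        exact Finset.sum_congr rfl fun x _ => sum_flip x (fun τ => (V - downCount τ + 1) * ‖v τ‖ ^ 2)
    _ = ∑ τ : TensorIndex Λ 2, (downCount τ : ℝ) * (V - downCount τ + 1) * ‖v τ‖ ^ 2 := by
        rw [Finset.sum_comm]
        refine Finset.sum_congr rfl fun τ _ => ?_
        rw [Finset.sum_ite, Finset.sum_const_zero, add_zero, Finset.sum_const, nsmul_eq_mul, downCount]
        ring

/-- **The Casimir ceiling for the crux observable**, for every vector:
`Re⟨v, ((S¹_tot)²+(S²_tot)²) v⟩ ≤ (|Λ|²/4 + |Λ|/2)‖v‖²`. [folklore] -/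
theorem re_quad_obsO_le (v : TensorIndex Λ 2 → ℂ) :
    (star v ⬝ᵥ (obsO Λ) *ᵥ v).re ≤
      ((Fintype.card Λ : ℝ) ^ 2 / 4 + Fintype.card Λ / 2) * (star v ⬝ᵥ v).re := by
  set V : ℝ := (Fintype.card Λ : ℝ) with hV
  rw [quad_obsO, Complex.add_re, re_star_dotProduct_self, re_quad_totalSpin_two,
    re_star_dotProduct_self]
  have hB := normSq_sumE_mulVec_sum_le v
  calc (∑ σ, ‖((∑ x : Λ, E x) *ᵥ v) σ‖ ^ 2) + ∑ σ, (V / 2 - downCount σ) * ‖v σ‖ ^ 2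
      ≤ ∑ τ, (downCount τ : ℝ) * (V - downCount τ + 1) * ‖v τ‖ ^ 2 +
          ∑ σ, (V / 2 - downCount σ) * ‖v σ‖ ^ 2 := by linarith
    _ = ∑ τ, ((downCount τ : ℝ) * (V - downCount τ) + V / 2) * ‖v τ‖ ^ 2 := by
        rw [← Finset.sum_add_distrib]
        refine Finset.sum_congr rfl fun τ _ => ?_
        ring
    _ ≤ ∑ τ, (V ^ 2 / 4 + V / 2) * ‖v τ‖ ^ 2 := by
        refine Finset.sum_le_sum fun τ _ => ?_
        apply mul_le_mul_of_nonneg_right _ (sq_nonneg _)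
        nlinarith [sq_nonneg (V - 2 * downCount τ)]
    _ = (V ^ 2 / 4 + V / 2) * ∑ τ, ‖v τ‖ ^ 2 := by rw [Finset.mul_sum]

variable (L : ℕ) [NeZero L]

/-- `Re ω(O) ≤ L⁶/4 + L³/2` for the tracial ground state of EVERY `H_pen(L,N)`. [folklore] -/
theorem re_gsf_obsO_le (N : ℕ) :
    ((Hpen L N).groundStateFunctional (obsO (TorusSite 3 L))).re ≤ (L : ℝ) ^ 6 / 4 + (L : ℝ) ^ 3 / 2 := by
  have hT : ∀ v ∈ (Hpen L N).groundSpace,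
      0 ≤ (star v ⬝ᵥ ((((L : ℝ) ^ 6 / 4 + (L : ℝ) ^ 3 / 2 : ℝ) : ℂ) • (1 : Op (TorusSite 3 L) 2) -
        obsO (TorusSite 3 L)) *ᵥ v).re := by
    intro v _
    have h := re_quad_obsO_le v
    rw [card_site] at h
    push_cast at h
    rw [sub_mulVec, dotProduct_sub, Complex.sub_re, smul_mulVec, one_mulVec, dotProduct_smul,
      smul_eq_mul, Complex.re_ofReal_mul]
    have h6 : ((L : ℝ) ^ 3) ^ 2 / 4 = (L : ℝ) ^ 6 / 4 := by ring
    rw [h6] at h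
    linarith
  have h := re_gsf_nonneg_of_groundSpace hT
  rw [map_sub, map_smul, groundStateFunctional_one (Hpen_isHermitian L _), Complex.sub_re,
    smul_eq_mul, mul_one, Complex.ofReal_re] at h
  linarith

/-- **Ceiling for the crux's right-hand side**: `rhs(L,N) ≤ L⁶/4 + N` at every `N`. [folklore] -/
theorem rhs_le (N : ℕ) : rhs L N ≤ (L : ℝ) ^ 6 / 4 + N := by
  rw [rhs]
  have := re_gsf_obsO_le L N
  linarith

end Casimir

/-- **(b) TIGHTNESS: any admissible constant is at most `½`.** At half filling `N = L³/2` the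
crux reads `c L⁶/2 ≤ Re ω(O) ≤ L⁶/4 + L³/2`. (Spin waves / QMC: `N₀/N ≈ 0.4` there.) [folklore] -/
theorem constant_le_half {c : ℝ} {L₀ : ℕ} (h : KineticLatticeBECWith c L₀) : c ≤ 1 / 2 := by
  by_contra hcon
  push Not at hcon
  have hd : 0 < c - 1 / 2 := by linarith
  obtain ⟨m, hm⟩ := exists_nat_gt (1 / (c - 1 / 2))
  set n : ℕ := L₀ + m + 1 with hn
  have hn1 : 1 ≤ n := by omega
  have hL0 : 2 * n ≠ 0 := by omega
  haveI : NeZero (2 * n) := ⟨hL0⟩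
  have hN1 : 1 ≤ 4 * n ^ 3 := by
    have := Nat.one_le_pow 3 n hn1
    omega
  have hN2 : 2 * (4 * n ^ 3) ≤ (2 * n) ^ 3 := le_of_eq (by ring)
  have key := h (2 * n) (by omega) ⟨n, two_mul n⟩ (4 * n ^ 3) hN1 hN2
  have hr := rhs_le (2 * n) (4 * n ^ 3)
  push_cast at key hr
  have hy1 : (1 : ℝ) ≤ n := by exact_mod_cast hn1
  have hym : (m : ℝ) ≤ n := by rw [hn]; push_cast; linarith
  have hcm : 1 < (c - 1 / 2) * m := by
    rw [div_lt_iff₀ hd] at hm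
    linarith
  have hcy : 1 < (c - 1 / 2) * n := lt_of_lt_of_le hcm (by nlinarith)
  -- key + hr : c * (4 n³) (2n)³ ≤ (2n)⁶/4 + 4n³, i.e. 32 c n⁶ ≤ 16 n⁶ + 4 n³
  have hy3 : (1 : ℝ) ≤ (n : ℝ) ^ 3 := one_le_pow₀ hy1
  have h1 : (c - 1 / 2) * 8 * (n : ℝ) ^ 3 ≤ 1 := by
    have hpos : (0 : ℝ) < 4 * (n : ℝ) ^ 3 := by positivity
    have hmain : c * (4 * (n : ℝ) ^ 3) * (2 * n) ^ 3 ≤ (2 * (n : ℝ)) ^ 6 / 4 + 4 * n ^ 3 :=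
      key.trans hr
    have : (4 * (n : ℝ) ^ 3) * ((c - 1 / 2) * 8 * (n : ℝ) ^ 3) ≤ (4 * (n : ℝ) ^ 3) * 1 := by
      nlinarith
    exact le_of_mul_le_mul_left this hpos
  have h2 : (n : ℝ) ≤ (n : ℝ) ^ 3 := le_self_pow₀ hy1 (by norm_num)
  nlinarith [mul_le_mul_of_nonneg_left h2 hd.le]

/-- **(c) A refuted strengthening: no constant above `½`**, in particular the "no depletion"
version `c = 1` of the crux is FALSE (interaction depletes the condensate; at half filling by at
least a factor two). [folklore] -/
theorem not_kineticLatticeBECWith_of_half_lt {c : ℝ} (hc : 1 / 2 < c) (L₀ : ℕ) :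
    ¬ KineticLatticeBECWith c L₀ := fun h =>
  absurd (constant_le_half h) (not_le.mpr hc)

/-- The `c = 1` instance ("`N₀ ≥ N`", zero depletion) is refuted at every `L₀`. [folklore] -/
theorem not_kineticLatticeBECWith_one (L₀ : ℕ) : ¬ KineticLatticeBECWith 1 L₀ :=
  not_kineticLatticeBECWith_of_half_lt (by norm_num) L₀


end Summit.AtomisticToContinuum.BoseEinsteinCondensation.Theorems.KineticLatticeBEC.Negative
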